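import Literature.NumberTheory.EllipticCurves.Pal2012.QuadraticTwistPeriodProofs
import Literature.NumberTheory.EllipticCurves.BSDQuadraticDescentArchimedeanProofs
import Literature.NumberTheory.EllipticCurves.ComplexPeriodProofs
import Literature.NumberTheory.EllipticCurves.BSDInvariantsProofs
import Literature.NumberTheory.EllipticCurves.ModularityVersionApProofs
import Literature.NumberTheory.EllipticCurves.LFunctionPrimeCoeff
import Literature.NumberTheory.EllipticCurves.HeegnerPoints
import Literature.NumberTheory.QuadraticFields.FundamentalDiscriminant
import Literature.NumberTheory.QuadraticFields.QuadraticDedekindZeta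
import Literature.NumberTheory.QuadraticFields.HeegnerCondition
import Summits.BirchSwinnertonDyer.Rank1Residual.Partition.TamagawaHeegnerAnyPrime
import Mathlib.NumberTheory.NumberField.Discriminant.Different
import HarnessLib

/-!
# Route `GenusKolyvaginAtTwo`, LINE 18 v4 (L_T `PowDvdShaCardAtTwoRT`, stmt-BirchSwinnertonDyer-23242),
# registered stub K `stub_genusIndexLaw` — factors (Ω), (C): THE PERIOD PRODUCT `Ω(W)·Ω(Wd) = Ω(W_K/K)` ON
# `Δ < 0`, AND `C(W_K) = C(W)²` AT A HEEGNER FIELD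

Seat `bsd-line-gk2-p2` g14 (cell `bsd-f1-sign2`), `--supports stmt-BirchSwinnertonDyer-23242` (helper; closes
nothing).  THEOREMS ONLY (no definition, no named fact, no `sorry`); UNCONDITIONAL; BSD is not proved by any of
this.  Companion of `…GenusIndexDescentAlgebra.lean` / `…GenusIndexRegulator.lean` (factor (R)); the assembly
of stub K is `…GenusIndexLaw.lean`.

The pen's stub K (`plus_descent.lean` v4): the Ш-free ratio `ρ = B(W)·B(Wd)/B(W_K)`, `B = Reg·Ω·C/#tors²`
(`regulator`, `bsdPeriod`, `modifiedTamagawaProduct`, `torsionOrder`), on the `Δ < 0` genus frame is a rational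
with `ord₂ ρ = ord₂ C(Wd) − 1`.  The two factors of this file (factor (T), odd torsion from `E[2] = 0`, is the
tree's `Literature.NumberTheory.EllipticCurves.odd_torsionOrder_of_forall_two_nsmul`):

* (Ω) **`bsdPeriod_mul_bsdPeriod_twin_eq`** — `W/ℚ` globally minimal with `Δ < 0`, `K` imaginary quadratic with
  ODD `d_K` satisfying the Heegner hypothesis for `N_W`, `Wd` a GLOBALLY MINIMAL model of `W^{(d_K)}`:
  `Ω(W)·Ω(Wd) = Ω(W_K/K)` EXACTLY, where `Ω = bsdPeriod` (`= realPeriodRat` over `ℚ`,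
  `= 2covol(Λ_W)/√|d_K|` over `K`, Dokchitser–Dokchitser Conj. 2.1).  Ingredients, all tree theorems: the
  archimedean comparison `Ω(W)·Ω(W^{(d_K)}) = n_W·Ω(W_K/K)` (`realPeriod_mul_realPeriod_quadraticTwist_eq_mul_bsdPeriod`,
  Milne 1972 §1), `n_W = numRealComponents = 1` for `Δ < 0`, and Pal 2012 Prop. 2.5 / Cor. 2.6 "`ũ = 1`"
  (`u_eq_one_or_eq_neg_one_of_smul_quadraticTwist_of_squarefree`): the scaling between `W^{(d_K)}` and the minimal
  `Wd` is `±1` because `d_K ≡ 1 (mod 4)` is square-free and `W` has GOOD reduction at every `p ∣ d_K` (a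
  ramified prime is not split, so `p ∤ N_W` under the Heegner hypothesis);
* (C) `tamagawaProduct_baseChange_eq_sq_of_heegner` — `∏_w c_w(W_K) = (∏_ℓ c_ℓ(W))²` when every `ℓ ∣ N_W`
  splits (cell b2b-bsdres `X11b.tamagawaProduct_baseChange_eq_sq_of_allSplit`, JSW 2017 (eq:tamK), Gross 1991
  (1.2)); with `modifiedTamagawaProduct = tamagawaProduct` on the three globally minimal models
  (`modifiedTamagawaProduct_eq_tamagawaProduct_of_isGloballyMinimal`,
  `modifiedTamagawaProduct_baseChange_eq_tamagawaProduct_of_isImaginaryQuadratic`).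

References: [Pal2012] Prop. 2.5, Cor. 2.6, Thm. 3.2; [Milne1972ArithmeticAV] §1; [DokchitserDokchitserAnnals2010]
Conj. 2.1; [GrossLMS1991] §1 (1.2); [JetchevSkinnerWan2017] §7.3.1 (eq:tamK); [SilvermanAEC2009] VII.5.1,
VIII.7, X.5.4; [Kramer1981] Prop. 3.
-/

set_option autoImplicit false
-- the Theorems namespace of this sub repeats the summit name by design (D-0017 nested layout)
set_option linter.dupNamespace false

noncomputable section

open scoped Classical

namespace Summit.BirchSwinnertonDyer.BirchSwinnertonDyer.Theorems.GenusExact.PlusDescent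

open WeierstrassCurve NumberField IsDedekindDomain Literature.NumberTheory.EllipticCurves
  Literature.NumberTheory.QuadraticFields

/-! ## (Ω) The period product on `Δ < 0` -/

section Period

variable (W : WeierstrassCurve ℚ) [W.IsElliptic] [W.IsGloballyMinimal]
  (K : Type) [Field K] [NumberField K]

omit [W.IsGloballyMinimal] in
/-- **Under the Heegner hypothesis `W` has good reduction at every prime dividing `d_K`**: a prime `p ∣ d_K`
ramifies in `K`, hence does not split (Dedekind: split ⇒ unramified ⇒ `p ∤ d_K`), so `p ∤ N_W`.
[cite: SilvermanAEC2009, VII.5.1] [cite: GrossLMS1991, §1 (p. 235)] -/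
theorem hasGoodReductionAt_of_dvd_discr_of_satisfiesHeegnerHypothesis (h2 : Module.finrank ℚ K = 2)
    (hH : SatisfiesHeegnerHypothesis (W.conductorNorm ℤ) K) (v : HeightOneSpectrum (𝓞 ℚ))
    (hv : ((Rat.HeightOneSpectrum.primesEquiv v : ℕ) : ℤ) ∣ NumberField.discr K) :
    W.HasGoodReductionAt v := by
  set p : ℕ := (Rat.HeightOneSpectrum.primesEquiv v : ℕ) with hpdef
  have hp : p.Prime := (Rat.HeightOneSpectrum.primesEquiv v).2
  haveI : Fact p.Prime := ⟨hp⟩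
  -- a split prime is unramified, hence prime to the discriminant
  have hns : ((Ideal.span {(p : ℤ)}).primesOver (𝓞 K)).ncard ≠ 2 := by
    intro hsplit
    have hpZ : Prime (p : ℤ) := Nat.prime_iff_prime_int.mp hp
    have hunr : ¬ (p : ℤ) ∣ NumberField.discr K := by
      rw [NumberField.not_dvd_discr_iff_isUnramifiedIn K (𝓞 K) hpZ,
        Algebra.isUnramifiedIn_iff_forall_ramificationIdx_eq_one]
      intro P _ hP
      have hmem : P ∈ (Ideal.span {(p : ℤ)}).primesOver (𝓞 K) := ⟨‹P.IsPrime›, hP⟩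
      have he := (SplitPrime.ramificationIdx_eq_one_of_ncard_primesOver hp (hsplit.trans h2.symm) hmem).1
      rwa [Ideal.ramificationIdx'_eq_ramificationIdx (Ideal.span {(p : ℤ)}) P
        (by simpa using hpZ.ne_zero)] at he
    exact hunr hv
  have hpN : ¬ p ∣ W.conductorNorm ℤ := fun h => hns (hH p hp h)
  have hgood : W.HasGoodReductionAtPrime p := by
    by_contra hbad
    exact hpN ((W.dvd_conductorNorm_iff_not_hasGoodReductionAtPrime p).mpr hbad)
  exact (hasGoodReductionAtPrime_primesEquiv_iff_holds W v p rfl).mp hgood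

/-- **The scaling between `W^{(d_K)}` and a globally minimal model is `±1`** for odd `d_K` at a Heegner field
(Pal 2012 Prop. 2.5 / Cor. 2.6 "`ũ = 1`": `d_K ≡ 1 (mod 4)` square-free and `W` good at every `p ∣ d_K`).
[cite: Pal2012, Prop. 2.5 and Cor. 2.6] -/
theorem u_eq_one_or_eq_neg_one_of_twin (h2 : Module.finrank ℚ K = 2) (hodd : Odd (NumberField.discr K))
    (hH : SatisfiesHeegnerHypothesis (W.conductorNorm ℤ) K) (Wd : WeierstrassCurve ℚ) [Wd.IsGloballyMinimal]
    (C : VariableChange ℚ) (hC : C • W.quadraticTwist (NumberField.discr K : ℚ) = Wd) :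
    (C.u : ℚ) = 1 ∨ (C.u : ℚ) = -1 := by
  have hd4 : NumberField.discr K % 4 = 1 := Quadratic.discr_emod_four_eq_one h2 hodd
  have hsq : Squarefree (NumberField.discr K) := by
    rcases Quadratic.isFundamentalDiscriminant_discr (K := K) h2 with ⟨-, hsq, -⟩ | ⟨h4, -, -⟩
    · exact hsq
    · exfalso
      rw [Int.odd_iff] at hodd
      omega
  exact W.u_eq_one_or_eq_neg_one_of_smul_quadraticTwist_of_squarefree hd4 hsq
    (fun v hv => Or.inl (hasGoodReductionAt_of_dvd_discr_of_satisfiesHeegnerHypothesis W K h2 hH v hv)) Wd C hC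

/-- **THE PERIOD PRODUCT (factor (Ω) of stub K).**  `W/ℚ` globally minimal elliptic with `Δ(W) < 0`, `K`
imaginary quadratic with odd `d_K` satisfying the Heegner hypothesis for `N_W`, `Wd` a globally minimal model of
`W^{(d_K)}`: **`Ω(W) · Ω(Wd) = Ω(W_K/K)`** (`Ω = bsdPeriod`; over `ℚ` the real period over all components, over
`K` `2covol(Λ_W)/√|d_K|`).  From `Ω(W)·Ω(W^{(d_K)}) = n_W·Ω(W_K/K)` (Milne 1972 §1 archimedean comparison,
tree), `n_W = 1` (`Δ < 0`: one real component) and `Ω(Wd) = |u|·Ω(W^{(d_K)})` with `u = ±1` (Pal 2012).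
UNCONDITIONAL. [cite: Milne1972ArithmeticAV, §1] [cite: Pal2012, Thm. 3.2 with Prop. 2.5]
[cite: DokchitserDokchitserAnnals2010, Conj. 2.1] -/
theorem bsdPeriod_mul_bsdPeriod_twin_eq (hΔ : W.Δ < 0) (hK : IsImaginaryQuadratic K)
    (hodd : Odd (NumberField.discr K)) (hH : SatisfiesHeegnerHypothesis (W.conductorNorm ℤ) K)
    (Wd : WeierstrassCurve ℚ) [Wd.IsElliptic] [Wd.IsGloballyMinimal]
    (hWd : ∃ C : VariableChange ℚ, C • W.quadraticTwist (NumberField.discr K : ℚ) = Wd) :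
    W.bsdPeriod * Wd.bsdPeriod = (W.baseChange K).bsdPeriod := by
  obtain ⟨C, hC⟩ := hWd
  have h2 : Module.finrank ℚ K = 2 := hK.1
  haveI : IsTotallyComplex K := hK.2
  -- `u = ±1`
  have hu : |((C.u : ℚ) : ℝ)| = 1 := by
    rcases u_eq_one_or_eq_neg_one_of_twin W K h2 hodd hH Wd C hC with h | h
    · rw [h]; simp
    · rw [h]; simp
  -- `Ω(Wd) = Ω(W^{(d_K)})`
  have hΩd : Wd.bsdPeriod = ((W.quadraticTwist (NumberField.discr K : ℚ)).baseChange ℝ).realPeriod := by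
    rw [bsdPeriod_eq_realPeriod_baseChange, ← WeierstrassCurve.realPeriodRat_def,
      ← WeierstrassCurve.realPeriodRat_def, ← hC,
      (W.quadraticTwist (NumberField.discr K : ℚ)).realPeriodRat_smul_holds C, hu, one_mul]
  -- one real component
  have hn : (W.baseChange ℝ).numRealComponents = 1 := by
    apply numRealComponents_of_Δ_nonpos
    rw [WeierstrassCurve.baseChange, map_Δ, eq_ratCast]
    exact_mod_cast hΔ.le
  have key := W.realPeriod_mul_realPeriod_quadraticTwist_eq_mul_bsdPeriod K h2
  rw [hn, Nat.cast_one, one_mul] at key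
  rw [bsdPeriod_eq_realPeriod_baseChange, hΩd]
  exact key

end Period

/-! ## (C) Tamagawa numbers at a Heegner field -/

section Tamagawa

variable (W : WeierstrassCurve ℚ) [W.IsElliptic] (K : Type) [Field K] [NumberField K]

/-- **`∏_w c_w(W_K) = (∏_ℓ c_ℓ(W))²` at a Heegner field** (every `ℓ ∣ N_W` splits: `c_w = c_w̄ = c_ℓ`; `c = 1`
above good primes).  The cell b2b-bsdres theorem `X11b.tamagawaProduct_baseChange_eq_sq_of_allSplit` read with
the route's `SatisfiesHeegnerHypothesis`. [cite: GrossLMS1991, §1 (1.2)] [cite: JetchevSkinnerWan2017, §7.3.1 (eq:tamK)] -/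
theorem tamagawaProduct_baseChange_eq_sq_of_heegner (h2 : Module.finrank ℚ K = 2)
    (hH : SatisfiesHeegnerHypothesis (W.conductorNorm ℤ) K) :
    (W.baseChange K).tamagawaProduct = W.tamagawaProduct ^ 2 :=
  Summit.BirchSwinnertonDyer.Rank1Residual.X11b.tamagawaProduct_baseChange_eq_sq_of_allSplit W K h2
    fun ℓ _ hℓN => hH ℓ Fact.out hℓN

/-- `∏_w c_w(W_K)` is odd when `∏_ℓ c_ℓ(W)` is, at a Heegner field. [cite: GrossLMS1991, §1 (1.2)] -/
theorem odd_tamagawaProduct_baseChange_of_heegner (h2 : Module.finrank ℚ K = 2)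
    (hH : SatisfiesHeegnerHypothesis (W.conductorNorm ℤ) K) (hT : Odd W.tamagawaProduct) :
    Odd (W.baseChange K).tamagawaProduct := by
  rw [tamagawaProduct_baseChange_eq_sq_of_heegner W K h2 hH]
  exact hT.pow

end Tamagawa

end Summit.BirchSwinnertonDyer.BirchSwinnertonDyer.Theorems.GenusExact.PlusDescent

end
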